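import Mathlib.Topology.Algebra.InfiniteSum.Constructions
import Mathlib.Topology.Algebra.InfiniteSum.ENNReal
import Summits.CriticalPhenomena.SAWScalingLimit.Theorems.SAWTotalPositivityBoundaryTP2Defs
import Summits.CriticalPhenomena.SAWScalingLimit.Theorems.SAWTotalPositivityBoundaryTP2Symmetry
import Summits.CriticalPhenomena.SAWScalingLimit.Theorems.SAWTotalPositivityBoundaryTP2SquareGadget
import Summits.CriticalPhenomena.SAWScalingLimit.Theorems.SAWTotalPositivityBoundaryTP2Strip3RecCornerAux
import HarnessLib

/-!
# Crux `BoundaryTP2` (stmt-CriticalPhenomena-7115), line `Sketch`: disjoint-pair sums at a leaf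

Helper file of the tool stub `stub_strip4_recCorner` (width-4 last-column recursion into a corner).
For a graph `K` on `V` with a *leaf* `ℓ` hanging on `c` (every neighbour of `ℓ` is `c`) and
`K' = K - ℓ = K.deleteEdges (K.incidenceSet ℓ)`, the disjoint-pair sums
`Σ_{(α, β)} [α ⊥ β] x^{|α|} x^{|β|}` over pairs of self-avoiding paths of `K` (`⊥` = vertex-disjoint
supports) reduce to disjoint-pair sums of `K'`:

* `s4c_pair_leaf_irrel`: if no endpoint is `ℓ`, nothing changes (paths between other vertices never
  visit a leaf);
* `s4c_pair_leaf_end`: if the first path ENDS at `ℓ`, peel its last edge `c ℓ`: a factor `x`;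
* `s4c_pair_leaf_start`: if the second path STARTS at `ℓ`, peel its first edge `ℓ c`: a factor `x`.

Each is a reparametrisation of the double sum along explicit bijections of path types
(`Equiv.tsum_eq`). Also: the pair sum vanishes when the first path ends where the second starts
(`s4c_pair_diag`) or under interlacing (`s4c_pair_interlaced`); reversal of the second path
(`s4c_pair_reverse_right`); a sum over a three-element neighbour set (`s4c_tsum_triple₂`); deleting four
vertices (`s4c_delete_four`). Everything proved; Mathlib and the landed toolkit only. [folklore]
-/

noncomputable section

namespace Summit.CriticalPhenomena.SAWScalingLimit.Theorems.BoundaryTP2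

open SimpleGraph Walk
open scoped ENNReal

variable {V : Type*}

/-! ## Walks at a leaf -/

/-- The edges of a walk of `K` avoiding `ℓ` are edges of `K - ℓ` (after `…BoundaryTP2Avoid`).
[folklore] -/
private theorem s4c_edges_avoid {K : SimpleGraph V} {ℓ u v : V} (p : K.Walk u v)
    (hℓ : ℓ ∉ p.support) : ∀ e, e ∈ p.edges → e ∈ (K.deleteEdges (K.incidenceSet ℓ)).edgeSet := by
  intro e he
  rw [edgeSet_deleteEdges]
  exact ⟨p.edges_subset_edgeSet he, fun hinc => hℓ (p.mem_support_of_mem_edges he hinc.2)⟩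

/-- A walk of `K - ℓ` issued from a vertex other than `ℓ` never visits `ℓ`. [folklore] -/
private theorem s4c_not_mem_of_deleted {K : SimpleGraph V} {ℓ u v : V}
    (p : (K.deleteEdges (K.incidenceSet ℓ)).Walk u v) (hu : u ≠ ℓ) : ℓ ∉ p.support :=
  s3dom_not_mem_support (fun z h => ((deleteEdges_incidenceSet_adj K ℓ z ℓ).1 h).2.2 rfl) p hu

/-- If every neighbour of `ℓ` is `c`, a walk from `ℓ` avoiding `c` is trivial
(after `…BoundaryTP2SquareGadget`). [folklore] -/
private theorem s4c_eq_of_walk_from_leaf {K : SimpleGraph V} {ℓ c : V}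
    (hleaf : ∀ z, K.Adj ℓ z → z = c) {v : V} (δ : K.Walk ℓ v) (hc : c ∉ δ.support) : ℓ = v := by
  cases δ with
  | nil => rfl
  | cons h δ' =>
    rw [support_cons, List.mem_cons, not_or] at hc
    obtain rfl := hleaf _ h
    exact absurd δ'.start_mem_support hc.2

/-- A leaf `ℓ` (every neighbour of `ℓ` is `c`) on a self-avoiding path is an endpoint: if it is not
the final vertex it is the initial one (after `…BoundaryTP2SquareGadget`). [folklore] -/
private theorem s4c_leaf_eq_start {K : SimpleGraph V} {ℓ c : V} (hleaf : ∀ z, K.Adj ℓ z → z = c) :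
    ∀ {u v : V} (δ : K.Walk u v), δ.IsPath → ℓ ≠ v → ℓ ∈ δ.support → ℓ = u := by
  intro u v δ
  induction δ with
  | nil =>
    intro _ _ hmem
    rwa [support_nil, List.mem_singleton] at hmem
  | cons h δ' ih =>
    intro hpath hne hmem
    rw [cons_isPath_iff] at hpath
    rw [support_cons, List.mem_cons] at hmem
    rcases hmem with hmem | hmem
    · exact hmem
    · obtain rfl := ih hpath.1 hne hmem
      obtain rfl := hleaf _ h.symm
      exact absurd (s4c_eq_of_walk_from_leaf hleaf δ' hpath.2) hne

/-! ## Three bijections of path types at a leaf -/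

/-- Paths of `K` between two vertices other than the leaf `ℓ` are the (transferred) paths of
`K - ℓ`, with the same support and length. [folklore] -/
private theorem s4c_exists_transfer {K : SimpleGraph V} {ℓ c a b : V}
    (hleaf : ∀ z, K.Adj ℓ z → z = c) (ha : a ≠ ℓ) (hb : b ≠ ℓ) :
    ∃ ι : (K.deleteEdges (K.incidenceSet ℓ)).Path a b → K.Path a b, Function.Bijective ι ∧
      ∀ δ, (ι δ).1.support = δ.1.support ∧ (ι δ).1.length = δ.1.length := by
  refine ⟨fun δ => ⟨δ.1.transfer K (s3dom_edges_of_le (deleteEdges_le _) δ.1), δ.2.transfer _⟩,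
    ⟨?_, ?_⟩, fun δ => ⟨support_transfer _ _, length_transfer _ _⟩⟩
  · intro δ δ' h
    have h' := congrArg (fun γ : K.Path a b => γ.1.edges) h
    simp only [edges_transfer] at h'
    exact Subtype.ext (edges_injective h')
  · intro γ
    have hℓ : ℓ ∉ γ.1.support := fun h => ha (s4c_leaf_eq_start hleaf γ.1 γ.2 hb.symm h).symm
    refine ⟨⟨γ.1.transfer _ (s4c_edges_avoid γ.1 hℓ), γ.2.transfer _⟩, Subtype.ext ?_⟩
    simp only [transfer_transfer, transfer_self]

/-- Paths of `K` from `a ≠ ℓ` INTO the leaf `ℓ` (hanging on `c`) are the paths `γ · (c ℓ)` for the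
paths `γ : a → c` of `K - ℓ`; support `γ ++ [ℓ]`, length `|γ| + 1`. [folklore] -/
private theorem s4c_exists_glueEnd {K : SimpleGraph V} {ℓ c a : V}
    (hleaf : ∀ z, K.Adj ℓ z → z = c) (hcl : K.Adj c ℓ) (ha : a ≠ ℓ) :
    ∃ g : (K.deleteEdges (K.incidenceSet ℓ)).Path a c → K.Path a ℓ, Function.Bijective g ∧
      ∀ γ, (g γ).1.support = γ.1.support ++ [ℓ] ∧ (g γ).1.length = γ.1.length + 1 := by
  have hP : ∀ γ : (K.deleteEdges (K.incidenceSet ℓ)).Path a c,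
      ((γ.1.transfer K (s3dom_edges_of_le (deleteEdges_le _) γ.1)).concat hcl).IsPath := fun γ =>
    (γ.2.transfer _).concat (by rw [support_transfer]; exact s4c_not_mem_of_deleted γ.1 ha) hcl
  refine ⟨fun γ => ⟨_, hP γ⟩, ⟨?_, ?_⟩, fun γ => ⟨?_, ?_⟩⟩
  · intro γ γ' h
    have h' := congrArg (fun δ : K.Path a ℓ => δ.1.edges) h
    simp only [edges_concat, edges_transfer, List.concat_eq_append] at h'
    exact Subtype.ext (edges_injective (List.append_cancel_right h'))
  · rintro ⟨α, hα⟩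
    obtain ⟨v, h, q, hq⟩ := exists_eq_cons_of_ne (Ne.symm ha) α.reverse
    obtain rfl : v = c := hleaf v h
    have hrev := hα.reverse
    rw [hq, cons_isPath_iff] at hrev
    have hℓq : ℓ ∉ q.reverse.support := by
      rw [support_reverse, List.mem_reverse]; exact hrev.2
    refine ⟨⟨q.reverse.transfer _ (s4c_edges_avoid q.reverse hℓq), hrev.1.reverse.transfer _⟩,
      Subtype.ext ?_⟩
    dsimp only
    rw [transfer_transfer, transfer_self]
    conv_rhs => rw [← reverse_reverse α, hq, reverse_cons]
    rfl
  · dsimp only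
    rw [support_concat, support_transfer]
  · dsimp only
    rw [length_concat, length_transfer]

/-- Paths of `K` OUT OF the leaf `ℓ` (hanging on `c`) to `b ≠ ℓ` are the paths `(ℓ c) · γ` for the
paths `γ : c → b` of `K - ℓ`; support `ℓ :: γ`, length `|γ| + 1`. [folklore] -/
private theorem s4c_exists_glueStart {K : SimpleGraph V} {ℓ c b : V}
    (hleaf : ∀ z, K.Adj ℓ z → z = c) (hlc : K.Adj ℓ c) (hb : b ≠ ℓ) :
    ∃ g : (K.deleteEdges (K.incidenceSet ℓ)).Path c b → K.Path ℓ b, Function.Bijective g ∧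
      ∀ γ, (g γ).1.support = ℓ :: γ.1.support ∧ (g γ).1.length = γ.1.length + 1 := by
  have hcℓ : c ≠ ℓ := hlc.ne.symm
  have hP : ∀ γ : (K.deleteEdges (K.incidenceSet ℓ)).Path c b,
      (cons hlc (γ.1.transfer K (s3dom_edges_of_le (deleteEdges_le _) γ.1))).IsPath := fun γ =>
    (cons_isPath_iff _ _).2 ⟨γ.2.transfer _, by
      rw [support_transfer]; exact s4c_not_mem_of_deleted γ.1 hcℓ⟩
  refine ⟨fun γ => ⟨_, hP γ⟩, ⟨?_, ?_⟩, fun γ => ⟨?_, ?_⟩⟩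
  · intro γ γ' h
    have h' := congrArg (fun δ : K.Path ℓ b => δ.1.edges) h
    simp only [edges_cons, edges_transfer, List.cons.injEq, true_and] at h'
    exact Subtype.ext (edges_injective h')
  · rintro ⟨β, hβ⟩
    cases β with
    | nil => exact absurd rfl hb
    | cons h q =>
      obtain rfl := hleaf _ h
      rw [cons_isPath_iff] at hβ
      refine ⟨⟨q.transfer _ (s4c_edges_avoid q hβ.2), hβ.1.transfer _⟩, Subtype.ext ?_⟩
      dsimp only
      rw [transfer_transfer, transfer_self]
  · dsimp only
    rw [support_cons, support_transfer]
  · dsimp only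
    rw [length_cons, length_transfer]

/-! ## Disjoint-pair sums at a leaf -/

open Classical in
/-- **A leaf off the endpoints is irrelevant for disjoint-pair sums.** If every neighbour of `ℓ` is
`c`, `K' = K - ℓ`, and `a, u, v, b ≠ ℓ`, the disjoint-pair sum over `(α : a → u, β : v → b)` is the
same for `K` and for `K'`. [folklore] -/
theorem s4c_pair_leaf_irrel (K K' : SimpleGraph V) (x : ℝ) {ℓ c a u v b : V}
    (hK' : K' = K.deleteEdges (K.incidenceSet ℓ)) (hleaf : ∀ z, K.Adj ℓ z → z = c)
    (ha : a ≠ ℓ) (hu : u ≠ ℓ) (hv : v ≠ ℓ) (hb : b ≠ ℓ) :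
    (∑' (α : K.Path a u) (β : K.Path v b),
      (if List.Disjoint α.1.support β.1.support then
        ENNReal.ofReal (x ^ α.1.length) * ENNReal.ofReal (x ^ β.1.length) else 0)) =
      ∑' (α : K'.Path a u) (β : K'.Path v b),
        (if List.Disjoint α.1.support β.1.support then
          ENNReal.ofReal (x ^ α.1.length) * ENNReal.ofReal (x ^ β.1.length) else 0) := by
  subst hK'
  obtain ⟨ι₁, hι₁, hι₁'⟩ := s4c_exists_transfer hleaf ha hu
  obtain ⟨ι₂, hι₂, hι₂'⟩ := s4c_exists_transfer hleaf hv hb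
  refine ((Equiv.ofBijective ι₁ hι₁).tsum_eq _).symm.trans (tsum_congr fun α => ?_)
  refine ((Equiv.ofBijective ι₂ hι₂).tsum_eq _).symm.trans (tsum_congr fun β => ?_)
  simp only [Equiv.ofBijective_apply]
  rw [(hι₁' α).1, (hι₁' α).2, (hι₂' β).1, (hι₂' β).2]

open Classical in
/-- **Peeling the last edge into a leaf.** If every neighbour of `ℓ` is `c ∼ ℓ`, `K' = K - ℓ`, and
`a, v, b ≠ ℓ`, then the disjoint-pair sum over `(α : a → ℓ, β : v → b)` of `K` is `x` times the
disjoint-pair sum over `(γ : a → c, β : v → b)` of `K'` (`0 ≤ x`). [folklore] -/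
theorem s4c_pair_leaf_end {V : Type*} (K K' : SimpleGraph V) (x : ℝ) (hx : 0 ≤ x) {ℓ c a v b : V}
    (hK' : K' = K.deleteEdges (K.incidenceSet ℓ)) (hleaf : ∀ z, K.Adj ℓ z → z = c)
    (hcl : K.Adj c ℓ) (ha : a ≠ ℓ) (hv : v ≠ ℓ) (hb : b ≠ ℓ) :
    (∑' (α : K.Path a ℓ) (β : K.Path v b),
      (if List.Disjoint α.1.support β.1.support then
        ENNReal.ofReal (x ^ α.1.length) * ENNReal.ofReal (x ^ β.1.length) else 0)) =
      ENNReal.ofReal x * ∑' (α : K'.Path a c) (β : K'.Path v b),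
        (if List.Disjoint α.1.support β.1.support then
          ENNReal.ofReal (x ^ α.1.length) * ENNReal.ofReal (x ^ β.1.length) else 0) := by
  subst hK'
  obtain ⟨g, hg, hg'⟩ := s4c_exists_glueEnd hleaf hcl ha
  obtain ⟨ι, hι, hι'⟩ := s4c_exists_transfer hleaf hv hb
  rw [← ENNReal.tsum_mul_left]
  refine ((Equiv.ofBijective g hg).tsum_eq _).symm.trans (tsum_congr fun γ => ?_)
  rw [← ENNReal.tsum_mul_left]
  refine ((Equiv.ofBijective ι hι).tsum_eq _).symm.trans (tsum_congr fun β => ?_)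
  simp only [Equiv.ofBijective_apply]
  rw [(hg' γ).1, (hg' γ).2, (hι' β).1, (hι' β).2]
  have hℓβ : ℓ ∉ β.1.support := s4c_not_mem_of_deleted β.1 hv
  by_cases hd : List.Disjoint γ.1.support β.1.support
  · rw [if_pos (List.disjoint_append_left.2 ⟨hd, List.singleton_disjoint.2 hℓβ⟩), if_pos hd,
      pow_succ, ENNReal.ofReal_mul (pow_nonneg hx _)]
    ring
  · rw [if_neg (fun h => hd (List.disjoint_append_left.1 h).1), if_neg hd, mul_zero]

open Classical in
/-- **Peeling the first edge out of a leaf.** If every neighbour of `ℓ` is `c ∼ ℓ`, `K' = K - ℓ`,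
and `a, u, b ≠ ℓ`, then the disjoint-pair sum over `(α : a → u, β : ℓ → b)` of `K` is `x` times the
disjoint-pair sum over `(α : a → u, γ : c → b)` of `K'` (`0 ≤ x`). [folklore] -/
theorem s4c_pair_leaf_start (K K' : SimpleGraph V) (x : ℝ) (hx : 0 ≤ x) {ℓ c a u b : V}
    (hK' : K' = K.deleteEdges (K.incidenceSet ℓ)) (hleaf : ∀ z, K.Adj ℓ z → z = c)
    (hlc : K.Adj ℓ c) (ha : a ≠ ℓ) (hu : u ≠ ℓ) (hb : b ≠ ℓ) :
    (∑' (α : K.Path a u) (β : K.Path ℓ b),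
      (if List.Disjoint α.1.support β.1.support then
        ENNReal.ofReal (x ^ α.1.length) * ENNReal.ofReal (x ^ β.1.length) else 0)) =
      ENNReal.ofReal x * ∑' (α : K'.Path a u) (β : K'.Path c b),
        (if List.Disjoint α.1.support β.1.support then
          ENNReal.ofReal (x ^ α.1.length) * ENNReal.ofReal (x ^ β.1.length) else 0) := by
  subst hK'
  obtain ⟨ι, hι, hι'⟩ := s4c_exists_transfer hleaf ha hu
  obtain ⟨g, hg, hg'⟩ := s4c_exists_glueStart hleaf hlc hb
  rw [← ENNReal.tsum_mul_left]
  refine ((Equiv.ofBijective ι hι).tsum_eq _).symm.trans (tsum_congr fun α => ?_)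
  rw [← ENNReal.tsum_mul_left]
  refine ((Equiv.ofBijective g hg).tsum_eq _).symm.trans (tsum_congr fun γ => ?_)
  simp only [Equiv.ofBijective_apply]
  rw [(hι' α).1, (hι' α).2, (hg' γ).1, (hg' γ).2]
  have hℓα : ℓ ∉ α.1.support := s4c_not_mem_of_deleted α.1 ha
  by_cases hd : List.Disjoint α.1.support γ.1.support
  · rw [if_pos (List.disjoint_cons_right.2 ⟨hℓα, hd⟩), if_pos hd, pow_succ,
      ENNReal.ofReal_mul (pow_nonneg hx _)]
    ring
  · rw [if_neg (fun h => hd (List.disjoint_cons_right.1 h).2), if_neg hd, mul_zero]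

/-! ## Vanishing, reversal, bookkeeping -/

open Classical in
/-- The disjoint-pair sum vanishes when the first path ends where the second starts. [folklore] -/
theorem s4c_pair_diag (K : SimpleGraph V) (x : ℝ) (a u b : V) :
    (∑' (α : K.Path a u) (β : K.Path u b),
      (if List.Disjoint α.1.support β.1.support then
        ENNReal.ofReal (x ^ α.1.length) * ENNReal.ofReal (x ^ β.1.length) else 0)) = 0 := by
  refine ENNReal.tsum_eq_zero.2 fun α => ENNReal.tsum_eq_zero.2 fun β => if_neg fun h => ?_
  exact h α.1.end_mem_support β.1.start_mem_support

open Classical in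
/-- The disjoint-pair sum over `(α : a → u, β : v → b)` vanishes if every path `a → u` meets every
path `v → b`. [folklore] -/
theorem s4c_pair_interlaced (K : SimpleGraph V) (x : ℝ) {a u v b : V} (hI : Interlaced K a v u b) :
    (∑' (α : K.Path a u) (β : K.Path v b),
      (if List.Disjoint α.1.support β.1.support then
        ENNReal.ofReal (x ^ α.1.length) * ENNReal.ofReal (x ^ β.1.length) else 0)) = 0 := by
  refine ENNReal.tsum_eq_zero.2 fun α => ENNReal.tsum_eq_zero.2 fun β => if_neg fun h => ?_
  obtain ⟨z, hz, hz'⟩ := hI α β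
  exact h hz hz'

open Classical in
/-- Reversing the second path of a disjoint-pair sum (a support- and length-preserving bijection).
[folklore] -/
theorem s4c_pair_reverse_right (K : SimpleGraph V) (x : ℝ) (a s u v : V) :
    (∑' (γ : K.Path a s) (γ' : K.Path u v),
      (if List.Disjoint γ.1.support γ'.1.support then
        ENNReal.ofReal (x ^ γ.1.length) * ENNReal.ofReal (x ^ γ'.1.length) else 0)) =
      ∑' (γ : K.Path a s) (γ' : K.Path v u),
        (if List.Disjoint γ.1.support γ'.1.support then
          ENNReal.ofReal (x ^ γ.1.length) * ENNReal.ofReal (x ^ γ'.1.length) else 0) := by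
  refine tsum_congr fun γ => ?_
  refine ((pathReverseEquiv K v u).tsum_eq _).symm.trans (tsum_congr fun γ' => ?_)
  simp only [pathReverseEquiv, Equiv.coe_fn_mk, support_reverse, List.disjoint_reverse_right,
    length_reverse]

/-- A sum over a three-element set of vertices. [folklore] -/
theorem s4c_tsum_triple [DecidableEq V] (f : V → ℝ≥0∞) {p q r : V} (hpq : p ≠ q) (hpr : p ≠ r)
    (hqr : q ≠ r) {N : Set V} (hN : N = {p, q, r}) : ∑' u : N, f u = f p + f q + f r := by
  have hcoe : N = ((({p, q, r} : Finset V) : Set V)) := by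
    rw [hN, Finset.coe_insert, Finset.coe_pair]
  have hp : p ∉ ({q, r} : Finset V) := by
    rw [Finset.mem_insert, Finset.mem_singleton, not_or]; exact ⟨hpq, hpr⟩
  calc ∑' u : N, f u = ∑' u : ((({p, q, r} : Finset V) : Set V)), f u := tsum_congr_set_coe f hcoe
    _ = ∑ u ∈ ({p, q, r} : Finset V), f u := Finset.tsum_subtype' _ f
    _ = f p + f q + f r := by rw [Finset.sum_insert hp, Finset.sum_pair hqr, add_assoc]

/-- A double sum over a three-element set of vertices: nine terms. [folklore] -/
theorem s4c_tsum_triple₂ [DecidableEq V] (f : V → V → ℝ≥0∞) {p q r : V} (hpq : p ≠ q) (hpr : p ≠ r)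
    (hqr : q ≠ r) {N : Set V} (hN : N = {p, q, r}) :
    ∑' (u : N) (v : N), f u v =
      (f p p + f p q + f p r) + (f q p + f q q + f q r) + (f r p + f r q + f r r) := by
  rw [s4c_tsum_triple (fun u => ∑' v : N, f u v) hpq hpr hqr hN, s4c_tsum_triple (f p) hpq hpr hqr hN,
    s4c_tsum_triple (f q) hpq hpr hqr hN, s4c_tsum_triple (f r) hpq hpr hqr hN]

/-- Deleting four vertices `t, c₁, c₂, c₃` one after the other yields the graph `G` of the edges of
`G'` between the other vertices (an equality of simple graphs on `V`). [folklore] -/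
theorem s4c_delete_four (G' G : SimpleGraph V) (t c₁ c₂ c₃ : V)
    (hG : ∀ u v, G.Adj u v ↔ G'.Adj u v ∧ (u ≠ t ∧ u ≠ c₁ ∧ u ≠ c₂ ∧ u ≠ c₃) ∧
      (v ≠ t ∧ v ≠ c₁ ∧ v ≠ c₂ ∧ v ≠ c₃)) :
    ((((G'.deleteEdges (G'.incidenceSet t)).deleteEdges
        ((G'.deleteEdges (G'.incidenceSet t)).incidenceSet c₁)).deleteEdges
        (((G'.deleteEdges (G'.incidenceSet t)).deleteEdges
          ((G'.deleteEdges (G'.incidenceSet t)).incidenceSet c₁)).incidenceSet c₂)).deleteEdges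
        ((((G'.deleteEdges (G'.incidenceSet t)).deleteEdges
          ((G'.deleteEdges (G'.incidenceSet t)).incidenceSet c₁)).deleteEdges
          (((G'.deleteEdges (G'.incidenceSet t)).deleteEdges
            ((G'.deleteEdges (G'.incidenceSet t)).incidenceSet c₁)).incidenceSet c₂)).incidenceSet c₃)) =
      G := by
  ext u v
  rw [deleteEdges_incidenceSet_adj, deleteEdges_incidenceSet_adj, deleteEdges_incidenceSet_adj,
    deleteEdges_incidenceSet_adj, hG]
  tauto

end Summit.CriticalPhenomena.SAWScalingLimit.Theorems.BoundaryTP2
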